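import Summits.QuantumFields.BalabanUV.T4Continuum.Support.RegionGaugeColumnsTower
import Summits.QuantumFields.BalabanUV.T4Continuum.Support.RegionGaugeColumnsTraceRegion

/-!
# T⁴ programme, spine node NE2 (U1a), sub-row Δ1 «NE2⁰-Dirichlet» — owner item O15-a, LEAF (B) «GAUGE-COLUMNS-TWO-LEVEL», file B3d:
# LEAF (B) ON ANY UNION OF UNIT BLOCKS, MODULO TWO DISPLAYED SCALAR BUDGETS OF THE ZERO-EXTENDED REGION SOLUTION

NE2 formalisation swarm `b2b-balaban-t4-ne2-formalise-*`, LEAF PROVER 05 (gen 9); INTENT journal `CLAIMS.log` 2026-08-21 l.23880 (the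
RE-ENTRANT front of owner R37 (e) / R40 (c) / R41 (d): the owner's O15-f `RegionGaugeResolventTowerRegion.hinjK_of_local_of_coercive` reduces
King's compressed injected law of the faithful `Δ_a(Ω₀)` on ANY union of unit blocks to the leaves (L) (B) (Bᵗ) (K); leaf-06-g7's
`RegionGaugeColumnsTraceRegion` (p241856) gives (Bᵗ) ⟸ (B) there modulo gan24's scalar budget).  The box proof of (B) (files B3c/B4a,
`RegionGaugeColumnsTwoLevel.opNorm_regionBh_succ_sub_le`) used the coordinate-box hypothesis in exactly TWO places: gan24's corner-free
`H²` identity (for the mixed and diagonal Hessians of the coarse solution) and leaf-07-g7's interior Gaffney inequality (for the deficient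
trace of its gradient, which also forced `2 ≤ n`).  THIS FILE displays the first and removes the second:

 * §1 ANY union `S`, ANY level `n ≥ 1`, `0 < a′`, with TWO budgets of `z_f = solExt f` displayed —
   `hΛ : ∀ f, Σ_μ budget M S n μ (solExt n M a′ Ω f) ≤ Λ·nsq f` (energy + interior DIAGONAL second differences — the SAME display as
   leaf-06-g7's region file) and `hΛm : ∀ f, Hmixed n (solExt n M a′ Ω f) ≤ Λm·nsq f` (the MIXED torus Hessian — King's face term; on a
   corner-free region `Hdiag + Hmixed = Σ_Ω|Δz|²`, on a re-entrant one this is where the corner coupling lives) —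
   **`nsq_columns_sub_le_of_budget`**: `nsq (B̂′φ − JstarR·B̂φ) ≤ CgaugeRsq d L a′ Λ Λm·n⁻¹·nsq φ` and
   **`opNorm_regionBh_succ_sub_le_of_budget`**: `‖regionBh (L·n) − JstarR·regionBh n‖ ≤ √(CgaugeRsq d L a′ Λ Λm)·(√n)⁻¹`,
   `CgaugeRsq := 3·(3·(2dL²Λm + 16d²L²Λ) + 2Λ + a′²γ′⁻²d)`.  The deficient trace of `u = B̂φ` is now paid by leaf-06-g7's spike-column bound
   `sum_deficient_normSq_regionBh_le_of_budget` (`Σ_def‖B̂φ‖² ≤ 2Λ‖φ‖²/n`, diagonal second differences only) instead of interior Gaffney —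
   hence no `2 ≤ n` and no box;
 * §2 ALONG THE STAR TOWER: **`hB_of_budget`** — level budgets `Λ_k`, `Λm_k` and a rate
   `√(CgaugeRsq d L a′ Λ_k Λm_k)·(√(n_k))⁻¹ ≤ CB·θ^k` give the owner's `hB` binder VERBATIM (same shape in `hinjK_of_local` and in
   `hinjK_of_local_of_coercive`);
 * §3 K-TEST on a coordinate box: `Λ = Lam d a′` (gan24 `sum_budget_solExt_le`) and `Λm = LamH d a′ = 2(1 + (a′γ′⁻¹)²)`
   (**`hmixed_solExt_le_box`**, corner-free `H²`) ⟹ **`hB_box'`**: `hB` on boxes at `θ = (√L)⁻¹` for EVERY rung with ONE formula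
   `CbBox' = √(CgaugeRsq d L a′ (Lam d a′) (LamH d a′))` (no rung-0 case split, cf. B4a's `hB_box`).

HONEST FRAMING (T4-DAG p. 1).  `U = 1`; ONE region = a union of unit blocks; ONE averaging scale; finite torus; operator norm; constants
OURS and crude; the two scalar budgets are DISPLAYED (theorems on coordinate boxes only — on re-entrant regions their level growth is the
located open estimate of the re-entrant front); `hinjK` / W3 OPEN beyond boxes and on boxes modulo (P-W); Δ1 NOT closed; NE2 (U1a) NOT
proved; spine PROVED 0/9 unchanged; NOT [B9] (3.16)/(3.23)–(3.27)/(3.42) as printed; NOT infinite volume / mass gap / Clay.  HONEST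
DEPENDENCY: continuum YM on T⁴ ⇐ BetaPertH ∧ nine spine estimates (0/9 proved); BetaPertH ⇐ (D1) ∧ (D4) ∧ CAP+tail; G-an2-4 gates asym,
D1 and NE2/3/4.  No `sorry`.
-/

noncomputable section

open scoped BigOperators ComplexConjugate Matrix Matrix.Norms.L2Operator
open Finset

namespace Summit.QuantumFields.BalabanUV.T4Continuum.RegionGaugeColumnsRegion

open Literature.MathematicalPhysics.QuantumFieldTheory.Balaban1983to89.B5Prop11Plancherel (Tor fine)
open Literature.MathematicalPhysics.QuantumFieldTheory.Balaban1983to89.B5Prop11Lower (nsq nsq_nonneg)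
open Literature.MathematicalPhysics.QuantumFieldTheory.Balaban1983to89.B5Action121 (sdiff LapS)
open Literature.MathematicalPhysics.QuantumFieldTheory.Balaban1983to89.B5G183RateUnitTower (lev)
open Summit.QuantumFields.BalabanUV.T4Continuum
open Summit.QuantumFields.BalabanUV.T4Continuum.SubtypeCompression (ext ext_apply_of_not nsq_ext)
open Summit.QuantumFields.BalabanUV.T4Continuum.ScalarAveragedPropagator (gammaPs gammaPs_pos dirichlet opNorm_le_of_nsq_le_rect nsq_GradOp_mulVec)
open Summit.QuantumFields.BalabanUV.T4Continuum.ScalarBlockPlanting (JK0)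
open Summit.QuantumFields.BalabanUV.T4Continuum.RegionGaugeFixedVector (starReg gradR)
open Summit.QuantumFields.BalabanUV.T4Continuum.RegionScalarCompression (GOm)
open Summit.QuantumFields.BalabanUV.T4Continuum.RegionGaugeResolventSplit (regionBh)
open Summit.QuantumFields.BalabanUV.T4Continuum.RegionStarTrace (defSet)
open Summit.QuantumFields.BalabanUV.T4Continuum.DirichletSubregionTowerOf (JpR)
open Summit.QuantumFields.BalabanUV.T4Continuum.DirichletStarVectorTower (starP)
open Summit.QuantumFields.BalabanUV.T4Continuum.CellTaylorPlanting (taylorJ JK0_mulVec norm_sq_mul_nsq_taylorJ_sub_JK0_le)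
open Summit.QuantumFields.BalabanUV.T4Continuum.RegionTaylorColumns (ext_gradR JstarR TcR TcR_mulVec gdefR hR nsq_gdefR_le nsq_hR_le
  sum_subtype_le_sum')
open Summit.QuantumFields.BalabanUV.T4Continuum.RegionGaugeColumnsIdentities (J0R J0R_mulVec fdata)
open Summit.QuantumFields.BalabanUV.T4Continuum.RegionGaugeColumnsTwoLevel (LamH regionBh_mulVec nsq_columns_sub_le nsq_fdata_le)
open Summit.QuantumFields.BalabanUV.T4Continuum.RegionGaugeColumnsTower (JpR_eq_JstarR inv_sqrt_lev)
open Summit.QuantumFields.BalabanUV.T4Continuum.RegionGaugeColumnsTraceRegion (sum_deficient_normSq_regionBh_le_of_budget)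
open Summit.QuantumFields.BalabanUV.Beta.GAN24.DirichletBoxCompression (solExt dirichlet_solExt_le sum_normSq_LapS_solExt_le)
open Summit.QuantumFields.BalabanUV.Beta.GAN24.DirichletBoxTrace (blockReg)
open Summit.QuantumFields.BalabanUV.Beta.GAN24.DirichletBoxTwoLevel (IsCoordBox cornerFree_blockReg budget Lam Lam_nonneg sum_budget_solExt_le)
open Summit.QuantumFields.BalabanUV.Beta.GAN24.DirichletBoxRegularity (Hdiag Hmixed sum_normSq_LapS_eq SuppIn hmixed_nonneg hdiag_nonneg)

variable {d : ℕ} (n L : ℕ) [NeZero n] [NeZero L] (M : Fin d → ℕ) [hM : ∀ μ, NeZero (M μ)] (a' : ℝ) (S : Tor M → Prop) [DecidablePred S]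

/-! ## §1 Leaf (B) on any union of blocks, modulo the two scalar budgets -/

/-- the (B) constant (squared) on a general region: `CgaugeRsq d L a′ Λ Λm := 3·(3·(2dL²Λm + 16d²L²Λ) + 2Λ + a′²γ′⁻²d)`. [folklore] -/
def CgaugeRsq (d L : ℕ) (a' Λ Λm : ℝ) : ℝ :=
  3 * (3 * (2 * d * (L : ℝ) ^ 2 * Λm + 16 * (d : ℝ) ^ 2 * (L : ℝ) ^ 2 * Λ) + 2 * Λ + a' ^ 2 * ((gammaPs d a')⁻¹) ^ 2 * d)

omit [NeZero L] in
/-- `0 ≤ CgaugeRsq` for nonnegative budgets. [folklore] -/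
theorem CgaugeRsq_nonneg {Λ Λm : ℝ} (hΛ : 0 ≤ Λ) (hΛm : 0 ≤ Λm) : 0 ≤ CgaugeRsq d L a' Λ Λm := by
  unfold CgaugeRsq; positivity

/-- the interior diagonal Hessian over the region is part of gan24's budget: `Hdiag_Ω z ≤ Σ_μ budget_μ z`. [folklore] -/
theorem hdiag_le_sum_budget (z : Tor (fine n M) → ℂ) :
    Hdiag (n : ℂ) (univ.filter (blockReg n M S)) z ≤ ∑ μ, budget M S n μ z := by
  unfold Hdiag budget
  exact Finset.sum_le_sum fun μ _ => le_add_of_nonneg_left (nsq_nonneg _)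

/-- **LEAF (B) IN `nsq` FORM ON ANY UNION OF BLOCKS, MODULO THE TWO SCALAR BUDGETS** (`n ≥ 1`):
`nsq (B̂′φ − JstarR·B̂φ) ≤ CgaugeRsq d L a′ Λ Λm·n⁻¹·nsq φ`. [folklore] -/
theorem nsq_columns_sub_le_of_budget (ha' : 0 < a') {Λ Λm : ℝ} (hΛ0 : 0 ≤ Λ) (hΛm0 : 0 ≤ Λm)
    (hΛ : ∀ f : {x // blockReg n M S x} → ℂ, ∑ μ, budget M S n μ (solExt n M a' (blockReg n M S) f) ≤ Λ * nsq f)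
    (hΛm : ∀ f : {x // blockReg n M S x} → ℂ, Hmixed (n : ℂ) (solExt n M a' (blockReg n M S) f) ≤ Λm * nsq f)
    (φ : {y // S y} → ℂ) :
    nsq (regionBh (L * n) M a' S *ᵥ φ - JstarR n L M S *ᵥ (regionBh n M a' S *ᵥ φ)) ≤ CgaugeRsq d L a' Λ Λm * (n : ℝ)⁻¹ * nsq φ := by
  have hγ := (gammaPs_pos (d := d) (a' := a')).1
  have hnpos : (0 : ℝ) < n := by exact_mod_cast Nat.pos_of_ne_zero (NeZero.ne n)
  have hn1 : (1 : ℝ) ≤ n := by exact_mod_cast Nat.pos_of_ne_zero (NeZero.ne n)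
  set f := fdata n M S φ with hf
  set ψ := GOm n M a' S *ᵥ f with hψ
  have hzsol : ext (blockReg n M S) ψ = solExt n M a' (blockReg n M S) f := rfl
  have hfφ : nsq f ≤ nsq φ := nsq_fdata_le n M S φ
  have hf0 := nsq_nonneg f
  have hφ0 := nsq_nonneg φ
  -- the budgets of the coarse solution
  have hE : nsq (gradR n M S *ᵥ ψ) ≤ (gammaPs d a')⁻¹ * nsq f := by
    rw [← nsq_ext (starReg n M S), ext_gradR, nsq_GradOp_mulVec, hzsol]
    exact dirichlet_solExt_le n M a' _ ha' f
  have hHd : Hdiag (n : ℂ) (univ.filter (blockReg n M S)) (ext (blockReg n M S) ψ) ≤ Λ * nsq f := by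
    rw [hzsol]; exact (hdiag_le_sum_budget n M S _).trans (hΛ f)
  have hHm : Hmixed (n : ℂ) (ext (blockReg n M S) ψ) ≤ Λm * nsq f := by rw [hzsol]; exact hΛm f
  -- the deficient trace of `u = B̂φ` by leaf-06-g7's spike columns (diagonal second differences only)
  have hT : ∑ b ∈ defSet n M S, ‖(gradR n M S *ᵥ ψ) b‖ ^ 2 ≤ 2 * Λ * nsq φ / n := by
    have h := sum_deficient_normSq_regionBh_le_of_budget n M S a' hΛ0 hΛ φ
    rw [regionBh_mulVec, ← hf, ← hψ] at h
    exact h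
  -- the three pieces
  have hG := nsq_gdefR_le n L M S ψ
  have hH := nsq_hR_le n L M S ψ
  have he : nsq (TcR n L M S *ᵥ ψ - J0R n L M S *ᵥ ψ) ≤ d * ((n : ℝ) ^ 2)⁻¹ * ((gammaPs d a')⁻¹ * nsq f) := by
    have h1 : nsq (TcR n L M S *ᵥ ψ - J0R n L M S *ᵥ ψ)
        ≤ nsq ((taylorJ n L M - JK0 n L M) *ᵥ ext (blockReg n M S) ψ) := by
      have e : ∀ a : {x // blockReg (L * n) M S x}, (TcR n L M S *ᵥ ψ - J0R n L M S *ᵥ ψ) a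
          = ((taylorJ n L M - JK0 n L M) *ᵥ ext (blockReg n M S) ψ) a.1 := fun a => by
        rw [Pi.sub_apply, TcR_mulVec, J0R_mulVec, Matrix.sub_mulVec, Pi.sub_apply, JK0_mulVec]
      calc nsq (TcR n L M S *ᵥ ψ - J0R n L M S *ᵥ ψ)
          = ∑ a : {x // blockReg (L * n) M S x}, ‖((taylorJ n L M - JK0 n L M) *ᵥ ext (blockReg n M S) ψ) a.1‖ ^ 2 := by
            unfold nsq; exact Finset.sum_congr rfl fun a _ => by rw [e a]
        _ ≤ _ := sum_subtype_le_sum' (blockReg (L * n) M S)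
            (F := fun x => ‖((taylorJ n L M - JK0 n L M) *ᵥ ext (blockReg n M S) ψ) x‖ ^ 2) fun _ => by positivity
    have h2 := norm_sq_mul_nsq_taylorJ_sub_JK0_le n L M (n : ℂ) (ext (blockReg n M S) ψ)
    rw [Complex.norm_natCast, ← ext_gradR, nsq_ext] at h2
    have hn2 : (0 : ℝ) < (n : ℝ) ^ 2 := by positivity
    calc nsq (TcR n L M S *ᵥ ψ - J0R n L M S *ᵥ ψ)
        ≤ ((n : ℝ) ^ 2)⁻¹ * ((n : ℝ) ^ 2 * nsq ((taylorJ n L M - JK0 n L M) *ᵥ ext (blockReg n M S) ψ)) := by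
          rw [← mul_assoc, inv_mul_cancel₀ hn2.ne', one_mul]; exact h1
      _ ≤ ((n : ℝ) ^ 2)⁻¹ * (d * nsq (gradR n M S *ᵥ ψ)) := mul_le_mul_of_nonneg_left h2 (inv_nonneg.mpr hn2.le)
      _ ≤ ((n : ℝ) ^ 2)⁻¹ * (d * ((gammaPs d a')⁻¹ * nsq f)) :=
          mul_le_mul_of_nonneg_left (mul_le_mul_of_nonneg_left hE (Nat.cast_nonneg _)) (inv_nonneg.mpr hn2.le)
      _ = _ := by ring
  refine (nsq_columns_sub_le n L M a' S ha' φ).trans ?_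
  rw [← hf, ← hψ]
  have hinv : ((n : ℝ) ^ 2)⁻¹ ≤ (n : ℝ)⁻¹ := by
    rw [inv_le_inv₀ (by positivity) hnpos]; nlinarith
  have hG' : nsq (gdefR n L M S ψ) ≤ (2 * d * (L : ℝ) ^ 2 * Λm + 16 * (d : ℝ) ^ 2 * (L : ℝ) ^ 2 * Λ) * (n : ℝ)⁻¹ * nsq φ := by
    refine hG.trans ?_
    have a1 : 2 * (d * (L : ℝ) ^ 2 * ((n : ℝ) ^ 2)⁻¹ * Hmixed (n : ℂ) (ext (blockReg n M S) ψ))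
        ≤ 2 * d * (L : ℝ) ^ 2 * Λm * (n : ℝ)⁻¹ * nsq φ := by
      have := mul_le_mul hinv (hHm.trans (mul_le_mul_of_nonneg_left hfφ hΛm0)) (hmixed_nonneg _ _) (inv_nonneg.mpr hnpos.le)
      calc 2 * (d * (L : ℝ) ^ 2 * ((n : ℝ) ^ 2)⁻¹ * Hmixed (n : ℂ) (ext (blockReg n M S) ψ))
          = 2 * d * (L : ℝ) ^ 2 * (((n : ℝ) ^ 2)⁻¹ * Hmixed (n : ℂ) (ext (blockReg n M S) ψ)) := by ring
        _ ≤ 2 * d * (L : ℝ) ^ 2 * ((n : ℝ)⁻¹ * (Λm * nsq φ)) := mul_le_mul_of_nonneg_left this (by positivity)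
        _ = _ := by ring
    have a2 : 2 * (4 * d * ((L * n : ℕ) : ℝ) ^ 2 * (d * ((n : ℝ) ^ 2)⁻¹ * ∑ b ∈ defSet n M S, ‖(gradR n M S *ᵥ ψ) b‖ ^ 2))
        ≤ 16 * (d : ℝ) ^ 2 * (L : ℝ) ^ 2 * Λ * (n : ℝ)⁻¹ * nsq φ := by
      have e1 : ((L * n : ℕ) : ℝ) ^ 2 * ((n : ℝ) ^ 2)⁻¹ = (L : ℝ) ^ 2 := by
        push_cast; field_simp
      calc 2 * (4 * d * ((L * n : ℕ) : ℝ) ^ 2 * (d * ((n : ℝ) ^ 2)⁻¹ * ∑ b ∈ defSet n M S, ‖(gradR n M S *ᵥ ψ) b‖ ^ 2))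
          = 8 * (d : ℝ) ^ 2 * (((L * n : ℕ) : ℝ) ^ 2 * ((n : ℝ) ^ 2)⁻¹) * ∑ b ∈ defSet n M S, ‖(gradR n M S *ᵥ ψ) b‖ ^ 2 := by ring
        _ ≤ 8 * (d : ℝ) ^ 2 * (L : ℝ) ^ 2 * (2 * Λ * nsq φ / n) := by
            rw [e1]; exact mul_le_mul_of_nonneg_left hT (by positivity)
        _ = _ := by rw [div_eq_mul_inv]; ring
    linarith
  have hH' : nsq (hR n L M S ψ) ≤ Λ * (n : ℝ)⁻¹ * nsq φ := by
    refine hH.trans ?_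
    calc ((n : ℝ) ^ 2)⁻¹ * Hdiag (n : ℂ) (univ.filter (blockReg n M S)) (ext (blockReg n M S) ψ)
        ≤ (n : ℝ)⁻¹ * (Λ * nsq φ) :=
          mul_le_mul hinv (hHd.trans (mul_le_mul_of_nonneg_left hfφ hΛ0)) (hdiag_nonneg _ _ _) (inv_nonneg.mpr hnpos.le)
      _ = _ := by ring
  have he' : a' ^ 2 * (gammaPs d a')⁻¹ * nsq (TcR n L M S *ᵥ ψ - J0R n L M S *ᵥ ψ)
      ≤ a' ^ 2 * ((gammaPs d a')⁻¹) ^ 2 * d * (n : ℝ)⁻¹ * nsq φ := by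
    calc a' ^ 2 * (gammaPs d a')⁻¹ * nsq (TcR n L M S *ᵥ ψ - J0R n L M S *ᵥ ψ)
        ≤ a' ^ 2 * (gammaPs d a')⁻¹ * (d * (n : ℝ)⁻¹ * ((gammaPs d a')⁻¹ * nsq φ)) := by
          refine mul_le_mul_of_nonneg_left (he.trans ?_) (by positivity)
          exact mul_le_mul (mul_le_mul_of_nonneg_left hinv (Nat.cast_nonneg _)) (mul_le_mul_of_nonneg_left hfφ (inv_nonneg.mpr hγ.le))
            (by positivity) (by positivity)
      _ = _ := by ring
  calc 3 * (3 * nsq (gdefR n L M S ψ) + 2 * nsq (hR n L M S ψ) + a' ^ 2 * (gammaPs d a')⁻¹ * nsq (TcR n L M S *ᵥ ψ - J0R n L M S *ᵥ ψ))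
      ≤ 3 * (3 * ((2 * d * (L : ℝ) ^ 2 * Λm + 16 * (d : ℝ) ^ 2 * (L : ℝ) ^ 2 * Λ) * (n : ℝ)⁻¹ * nsq φ)
          + 2 * (Λ * (n : ℝ)⁻¹ * nsq φ) + a' ^ 2 * ((gammaPs d a')⁻¹) ^ 2 * d * (n : ℝ)⁻¹ * nsq φ) := by
        nlinarith [hG', hH', he']
    _ = CgaugeRsq d L a' Λ Λm * (n : ℝ)⁻¹ * nsq φ := by unfold CgaugeRsq; ring

/-- **LEAF (B) ON ANY UNION OF UNIT BLOCKS, MODULO THE TWO SCALAR BUDGETS** (`n ≥ 1`, `0 < a′`):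
`‖regionBh (L·n) − JstarR·regionBh n‖ ≤ √(CgaugeRsq d L a′ Λ Λm)·(√n)⁻¹`. [folklore] -/
theorem opNorm_regionBh_succ_sub_le_of_budget (ha' : 0 < a') {Λ Λm : ℝ} (hΛ0 : 0 ≤ Λ) (hΛm0 : 0 ≤ Λm)
    (hΛ : ∀ f : {x // blockReg n M S x} → ℂ, ∑ μ, budget M S n μ (solExt n M a' (blockReg n M S) f) ≤ Λ * nsq f)
    (hΛm : ∀ f : {x // blockReg n M S x} → ℂ, Hmixed (n : ℂ) (solExt n M a' (blockReg n M S) f) ≤ Λm * nsq f) :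
    ‖regionBh (L * n) M a' S - JstarR n L M S * regionBh n M a' S‖ ≤ Real.sqrt (CgaugeRsq d L a' Λ Λm) * (Real.sqrt n)⁻¹ := by
  have hnpos : (0 : ℝ) < n := by exact_mod_cast Nat.pos_of_ne_zero (NeZero.ne n)
  refine opNorm_le_of_nsq_le_rect _ (by positivity) fun φ => ?_
  rw [Matrix.sub_mulVec, ← Matrix.mulVec_mulVec, mul_pow, Real.sq_sqrt (CgaugeRsq_nonneg L a' hΛ0 hΛm0), inv_pow,
    Real.sq_sqrt hnpos.le]
  exact nsq_columns_sub_le_of_budget n L M a' S ha' hΛ0 hΛm0 hΛ hΛm φ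

/-! ## §2 Along the star tower: the owner's `hB` binder from level budgets -/

/-- **`hB` FROM LEVEL BUDGETS ON ANY UNION OF BLOCKS**: budgets `Λ_k`, `Λm_k` of the level-`k` region solutions and a rate
`√(CgaugeRsq d L a′ Λ_k Λm_k)·(√(n_k))⁻¹ ≤ CB·θ^k` give the owner's `hB` VERBATIM (the binder of `hinjK_of_local` /
`hinjK_of_local_of_coercive` / `hBt_of_hB_of_budget`). [folklore] -/
theorem hB_of_budget (ha' : 0 < a') {Λ Λm : ℕ → ℝ} (hΛ0 : ∀ k, 0 ≤ Λ k) (hΛm0 : ∀ k, 0 ≤ Λm k)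
    (hΛ : ∀ (k : ℕ) (f : {x // blockReg (lev L k) M S x} → ℂ),
      ∑ μ, budget M S (lev L k) μ (solExt (lev L k) M a' (blockReg (lev L k) M S) f) ≤ Λ k * nsq f)
    (hΛm : ∀ (k : ℕ) (f : {x // blockReg (lev L k) M S x} → ℂ),
      Hmixed ((lev L k : ℕ) : ℂ) (solExt (lev L k) M a' (blockReg (lev L k) M S) f) ≤ Λm k * nsq f)
    {θ CB : ℝ} (hrate : ∀ k, Real.sqrt (CgaugeRsq d L a' (Λ k) (Λm k)) * (Real.sqrt ((lev L k : ℕ) : ℝ))⁻¹ ≤ CB * θ ^ k) (k : ℕ) :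
    ‖regionBh (lev L (k + 1)) M a' S - JpR L M (starP L M S) k * regionBh (lev L k) M a' S‖ ≤ CB * θ ^ k := by
  rw [JpR_eq_JstarR]
  exact (opNorm_regionBh_succ_sub_le_of_budget (lev L k) L M a' S ha' (hΛ0 k) (hΛm0 k) (hΛ k) (hΛm k)).trans (hrate k)

/-! ## §3 K-test: the coordinate box -/

/-- **THE MIXED-HESSIAN BUDGET ON A COORDINATE BOX**: `Hmixed n (solExt f) ≤ 2(1 + (a′γ′⁻¹)²)·nsq f` at EVERY level `n ≥ 1`
(gan24's corner-free `H²` identity `Hdiag + Hmixed = Σ_Ω|Δz|²` + `sum_normSq_LapS_solExt_le`). [folklore] -/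
theorem hmixed_solExt_le_box (hS : IsCoordBox M S) (ha' : 0 < a') (f : {x // blockReg n M S x} → ℂ) :
    Hmixed (n : ℂ) (solExt n M a' (blockReg n M S) f) ≤ LamH d a' * nsq f := by
  set z := solExt n M a' (blockReg n M S) f with hz
  have hsupp : SuppIn (fine n M) (univ.filter (blockReg n M S)) z := by
    intro x hx
    rw [Finset.mem_filter] at hx
    exact ext_apply_of_not _ _ (fun h => hx ⟨Finset.mem_univ _, h⟩)
  have hLap : ∑ x ∈ univ.filter (blockReg n M S), ‖(LapS (fine n M) (n : ℂ) *ᵥ z) x‖ ^ 2 ≤ LamH d a' * nsq f := by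
    have h2 : ∑ x ∈ univ.filter (blockReg n M S), ‖(LapS (fine n M) (n : ℂ) *ᵥ z) x‖ ^ 2
        = ∑ a : {x // blockReg n M S x}, ‖(LapS (fine n M) (n : ℂ) *ᵥ z) a‖ ^ 2 :=
      Finset.sum_subtype _ (fun x => by simp) (fun x => ‖(LapS (fine n M) (n : ℂ) *ᵥ z) x‖ ^ 2)
    rw [h2, hz]
    exact sum_normSq_LapS_solExt_le n M a' _ ha' f
  have e := sum_normSq_LapS_eq (cornerFree_blockReg M S hS n) hsupp (n : ℂ)
  have := hdiag_nonneg (n : ℂ) (univ.filter (blockReg n M S)) z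
  linarith

omit [NeZero L] hM [DecidablePred S] in
/-- `0 ≤ LamH`. [folklore] -/
theorem LamH_nonneg : 0 ≤ LamH d a' := by unfold LamH; positivity

/-- the box constant with one formula for every rung: `CbBox' d L a′ := √(CgaugeRsq d L a′ (Lam d a′) (LamH d a′))`. [folklore] -/
def CbBox' (d L : ℕ) (a' : ℝ) : ℝ := Real.sqrt (CgaugeRsq d L a' (Lam d a') (LamH d a'))

/-- **K-TEST — `hB` ON A COORDINATE BOX AT `θ = (√L)⁻¹`, EVERY RUNG, ONE FORMULA** (re-derives B4a's `hB_box` through the general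
theorem; no `2 ≤ L`, no rung-0 case). [folklore] -/
theorem hB_box' (hS : IsCoordBox M S) (ha' : 0 < a') (k : ℕ) :
    ‖regionBh (lev L (k + 1)) M a' S - JpR L M (starP L M S) k * regionBh (lev L k) M a' S‖ ≤ CbBox' d L a' * ((Real.sqrt (L : ℝ))⁻¹) ^ k := by
  refine hB_of_budget L M a' S ha' (Λ := fun _ => Lam d a') (Λm := fun _ => LamH d a') (fun _ => Lam_nonneg (d := d) a')
    (fun _ => LamH_nonneg a') (fun j f => sum_budget_solExt_le M S hS (lev L j) ha' _ (fun _ => Iff.rfl) f)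
    (fun j f => hmixed_solExt_le_box (lev L j) M a' S hS ha' f) (fun j => le_of_eq ?_) k
  rw [inv_sqrt_lev L j]
  rfl

end Summit.QuantumFields.BalabanUV.T4Continuum.RegionGaugeColumnsRegion

end
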